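import Literature.AlgebraicGeometry.Morphisms.IrreducibleAffineNeighbourhood
import Literature.AlgebraicGeometry.Motives.CyclesDimensionProofs
import Literature.AlgebraicGeometry.Motives.AbelianVarietyProofs
import Mathlib.RingTheory.RegularLocalRing.Defs
import HarnessLib

/-!
# Smooth of relative dimension `n` over a field, read off the closed points

Topic: `Literature/AlgebraicGeometry/Dimension`. THEOREMS ONLY (no definition, no named fact, no
instance, no `sorry`).

For a morphism `f : X → Spec K` to a field which is SMOOTH (Mathlib `AlgebraicGeometry.Smooth`), the
relative dimension is locally constant and is read at any closed point `x` as `dim 𝒪_{X,x}`, or —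
the local rings being regular ([StacksProject, Tag 056S]) — as the dimension of the Zariski
(co)tangent space `𝔪_x/𝔪_x²` over `κ(x)` ([GortzWedhorn2020, Def. 6.14, Prop. 6.15 (1), Lemma 6.26 «If `x` is
closed, then `dim 𝒪_{X,x} = d`», Thm. 6.28 (i) ⇔ (v) ⇒ (vi)]).  Hence:

* `ringKrullDim_stalk_eq_of_smoothOfRelativeDimension_of_isClosed` — if `f` is smooth of relative
  dimension `n`, then `dim 𝒪_{X,x} = n` at every CLOSED point `x` (no irreducibility hypothesis: the
  tree's `Resolution.SNCStrataSmooth.ringKrullDim_stalk_eq_of_isClosed_singleton` assumes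
  `IrreducibleSpace X`; here one localises to an affine irreducible open neighbourhood,
  `Morphisms.exists_isAffineOpen_irreducibleSpace_of_smooth`);
* `finrank_cotangentSpace_stalk_eq_of_smoothOfRelativeDimension_of_isClosed` — and
  `dim_{κ(x)} 𝔪_x/𝔪_x² = n` there;
* **`smoothOfRelativeDimension_of_forall_isClosed_ringKrullDim_stalk_eq`** — conversely, if `f` is
  smooth and `dim 𝒪_{X,x} = n` at every closed point, then `f` is smooth of relative dimension `n`
  (charts of SOME relative dimension `d` around every point, `Motives.exists_smoothOfRelativeDimension_of_smooth`
  on an irreducible affine open; a closed point of `X` inside the chart — `X` is Jacobson, Mathlib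
  `LocallyOfFiniteType.jacobsonSpace` — forces `d = n`; glue by `IsZariskiLocalAtSource`);
* **`smoothOfRelativeDimension_of_forall_isClosed_finrank_cotangentSpace_eq`** — the same with the
  tangent-space count `dim_{κ(x)} 𝔪_x/𝔪_x² = n` at closed points (the form in which deformation
  theory delivers the relative dimension of a smooth moduli scheme: a hull `Λ[[t₁,…,t_r]]`
  pro-representing the deformation functor at a closed point gives `dim 𝔪_x/𝔪_x² = r`,
  [Lan2013PELCompactifications, Cor. 2.2.4.13, Thm. 2.2.4.14, Prop. 2.3.5.2]);
* the `iff` packagings `smoothOfRelativeDimension_iff_forall_isClosed_ringKrullDim_stalk_eq`,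
  `smoothOfRelativeDimension_iff_forall_isClosed_finrank_cotangentSpace_eq`.

Cell hodgecm-mathlib (e-def road of the EQUIDIM clause `SmoothOfRelativeDimension (g(g+1)/2) 𝓜.M.hom`
of the Siegel fine moduli scheme, `B-plan/memo/E-EQUIDIM-FILING.md` §2): this file is the
Mathlib-currency glue «smooth + tangent count `r` at closed points ⇒ smooth of relative dimension
`r`», stated once for any field `K` and any `K`-scheme.  HC_CM is proved only modulo the 7 printed
citations until rung 0 closes; this file discharges none of them.

## References

* [GortzWedhorn2020] U. Görtz, T. Wedhorn, *Algebraic Geometry I*, 2nd ed. (2020): Prop. 3.35 (closed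
  points very dense), Def. 6.14, Prop. 6.15 (1), Lemma 6.26, Thm. 6.28, Cor. 6.29.
* [StacksProject] The Stacks Project, Tag 056S (Lemma 33.25.3: smooth over a field ⇒ regular).
* [Lan2013PELCompactifications] K.-W. Lan, *Arithmetic compactifications of PEL-type Shimura
  varieties* (2013): Cor. 2.2.4.13 (p. 149), Thm. 2.2.4.14 (p. 150), Prop. 2.3.5.2 (p. 156).
-/

set_option autoImplicit false

noncomputable section

universe u

open CategoryTheory AlgebraicGeometry TopologicalSpace IsLocalRing

namespace Literature.AlgebraicGeometry.Dimension

variable {K : Type u} [Field K] {X : Scheme.{u}} (f : X ⟶ Spec (CommRingCat.of K))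

/-! ### Local rings of open subschemes; closed points inside opens -/

/-- The local ring of an open subscheme `U ⊆ X` at `y` has the same dimension as `𝒪_{X,y}` (the
stalk map of the open immersion `U ↪ X` is an isomorphism; private twin of the tree's
`Resolution.ringKrullDim_stalk_opens`, whose module is too heavy to import here). [folklore] -/
private theorem ringKrullDim_stalk_opens (U : X.Opens) (y : ↥(U : Scheme.{u})) :
    ringKrullDim ((U : Scheme.{u}).presheaf.stalk y) = ringKrullDim (X.presheaf.stalk (U.ι y)) := by
  haveI : IsIso (U.ι.stalkMap y) := (IsOpenImmersion.iff_isIso_stalkMap.mp inferInstance).2 y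
  exact (ringKrullDim_eq_of_ringEquiv (asIso (U.ι.stalkMap y)).commRingCatIsoToRingEquiv).symm

/-- A point of an open `U ⊆ X` which is closed in `X` is closed in the open subscheme `U`. [folklore] -/
private theorem isClosed_singleton_opens {U : X.Opens} {x : X} (hxU : x ∈ U)
    (hx : IsClosed ({x} : Set X)) : IsClosed ({(⟨x, hxU⟩ : ↥(U : Scheme.{u}))} : Set ↥(U : Scheme.{u})) := by
  have h : ({(⟨x, hxU⟩ : ↥(U : Scheme.{u}))} : Set ↥(U : Scheme.{u})) =
      (fun y : ↥(U : Scheme.{u}) => (U.ι y : X)) ⁻¹' {x} := by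
    ext y
    simp only [Set.mem_singleton_iff, Set.mem_preimage, Scheme.Opens.ι_apply]
    constructor
    · rintro rfl; rfl
    · intro hy; exact Subtype.ext hy
  rw [h]
  exact hx.preimage U.ι.continuous

/-- **A non-empty open of a scheme locally of finite type over a field contains a closed point of
the ambient scheme** (`X` is a Jacobson space, Mathlib `LocallyOfFiniteType.jacobsonSpace`).
[cite: GortzWedhorn2020, Prop. 3.35] -/
theorem exists_mem_isClosed_singleton_of_mem_opens [LocallyOfFiniteType f] {U : X.Opens} {x : X}
    (hxU : x ∈ U) : ∃ x' : X, x' ∈ U ∧ IsClosed ({x'} : Set X) := by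
  haveI : JacobsonSpace X := LocallyOfFiniteType.jacobsonSpace f
  obtain ⟨x', hx'U, hx'⟩ := nonempty_inter_closedPoints (Z := (U : Set X)) ⟨x, hxU⟩ U.2.isLocallyClosed
  exact ⟨x', hx'U, hx'⟩

/-! ### From the relative dimension to the closed points -/

/-- **At a closed point of a scheme smooth of relative dimension `n` over a field, `dim 𝒪_{X,x} = n`**
(no irreducibility hypothesis on `X`): localise to an affine irreducible open neighbourhood `U ∋ x`
(`Morphisms.exists_isAffineOpen_irreducibleSpace_of_smooth`), where `height + coheight = n`
(`Motives.height_add_coheight_eq_of_smoothOfRelativeDimension`) and `height x = 0`.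
[cite: GortzWedhorn2020, Lemma 6.26 and Thm. 6.28 (vi)] -/
theorem ringKrullDim_stalk_eq_of_smoothOfRelativeDimension_of_isClosed (n : ℕ)
    [SmoothOfRelativeDimension n f] {x : X} (hx : IsClosed ({x} : Set X)) :
    ringKrullDim (X.presheaf.stalk x) = n := by
  haveI : Smooth f := SmoothOfRelativeDimension.smooth n f
  obtain ⟨U, -, hxU, hirr⟩ :=
    Literature.AlgebraicGeometry.Morphisms.exists_isAffineOpen_irreducibleSpace_of_smooth f x
  haveI := hirr
  haveI : SmoothOfRelativeDimension n (U.ι ≫ f) := by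
    have h := (inferInstance : SmoothOfRelativeDimension (0 + n) (U.ι ≫ f))
    rwa [Nat.zero_add] at h
  have hxU' : IsClosed ({(⟨x, hxU⟩ : ↥(U : Scheme.{u}))} : Set ↥(U : Scheme.{u})) :=
    isClosed_singleton_opens hxU hx
  have h := Literature.AlgebraicGeometry.Motives.height_add_coheight_eq_of_smoothOfRelativeDimension
    (U.ι ≫ f) n (⟨x, hxU⟩ : ↥(U : Scheme.{u}))
  rw [Scheme.height_of_isClosed hxU', zero_add] at h
  have e := ringKrullDim_stalk_opens U ⟨x, hxU⟩
  rw [Scheme.Opens.ι_apply] at e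
  change ringKrullDim ((U : Scheme.{u}).presheaf.stalk ⟨x, hxU⟩) = ringKrullDim (X.presheaf.stalk x) at e
  rw [← e, ringKrullDim_stalk_eq_coheight, h]
  rfl

/-- **At a closed point of a scheme smooth of relative dimension `n` over a field the Zariski
cotangent space `𝔪_x/𝔪_x²` has dimension `n` over `κ(x)`** — the local ring is regular
([StacksProject, Tag 056S], `Resolution.isRegularLocalRing_stalk_of_smooth_of_field`) of dimension
`n`. [cite: GortzWedhorn2020, Thm. 6.28 (vi)] [cite: StacksProject, Tag 056S] -/
theorem finrank_cotangentSpace_stalk_eq_of_smoothOfRelativeDimension_of_isClosed (n : ℕ)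
    [SmoothOfRelativeDimension n f] {x : X} (hx : IsClosed ({x} : Set X)) :
    (Module.finrank (ResidueField (X.presheaf.stalk x)) (CotangentSpace (X.presheaf.stalk x)) :
      WithBot ℕ∞) = n := by
  haveI : Smooth f := SmoothOfRelativeDimension.smooth n f
  haveI := Literature.AlgebraicGeometry.Resolution.isRegularLocalRing_stalk_of_smooth_of_field f x
  rw [(IsRegularLocalRing.iff_finrank_cotangentSpace _).mp this]
  exact ringKrullDim_stalk_eq_of_smoothOfRelativeDimension_of_isClosed f n hx

/-! ### From the closed points to the relative dimension -/

/-- **A smooth scheme over a field whose local rings at closed points all have dimension `n` is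
smooth of relative dimension `n`.**  Around any point `x` there is an affine irreducible open `U`
on which `f` is smooth of SOME relative dimension `d` (`Motives.exists_smoothOfRelativeDimension_of_smooth`);
`U` contains a closed point `x'` of `X` (Jacobson), where `d = dim 𝒪_{X,x'} = n`; the `n`-charts
cover `X` and smoothness of relative dimension `n` is Zariski-local on the source.
[cite: GortzWedhorn2020, Prop. 6.15 (1), Lemma 6.26 and Prop. 3.35] -/
theorem smoothOfRelativeDimension_of_forall_isClosed_ringKrullDim_stalk_eq [Smooth f] (n : ℕ)
    (h : ∀ x : X, IsClosed ({x} : Set X) → ringKrullDim (X.presheaf.stalk x) = n) :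
    SmoothOfRelativeDimension n f := by
  have key : ∀ x : X, ∃ U : X.Opens, x ∈ U ∧ SmoothOfRelativeDimension n (U.ι ≫ f) := by
    intro x
    obtain ⟨U, -, hxU, hirr⟩ :=
      Literature.AlgebraicGeometry.Morphisms.exists_isAffineOpen_irreducibleSpace_of_smooth f x
    haveI := hirr
    obtain ⟨d, hd⟩ :=
      Literature.AlgebraicGeometry.Motives.exists_smoothOfRelativeDimension_of_smooth (U.ι ≫ f)
    obtain ⟨x', hx'U, hx'⟩ := exists_mem_isClosed_singleton_of_mem_opens f hxU
    haveI := hd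
    have h1 := ringKrullDim_stalk_eq_of_smoothOfRelativeDimension_of_isClosed (U.ι ≫ f) d
      (isClosed_singleton_opens hx'U hx')
    rw [ringKrullDim_stalk_opens U ⟨x', hx'U⟩, Scheme.Opens.ι_apply, h x' hx'] at h1
    have hdn : d = n := by exact_mod_cast h1.symm
    exact ⟨U, hxU, hdn ▸ hd⟩
  choose U hxU hU using key
  have htop : ⨆ x, U x = ⊤ := top_le_iff.mp fun x _ => Opens.mem_iSup.mpr ⟨x, hxU x⟩
  rw [IsZariskiLocalAtSource.iff_of_iSup_eq_top (P := @SmoothOfRelativeDimension n) U htop]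
  exact hU

/-- **A smooth scheme over a field whose Zariski tangent spaces at closed points all have
dimension `n` is smooth of relative dimension `n`** (the local rings are regular, so
`dim_{κ(x)} 𝔪_x/𝔪_x² = dim 𝒪_{X,x}`). [cite: GortzWedhorn2020, Thm. 6.28 and Lemma 6.26] [cite: StacksProject, Tag 056S] -/
theorem smoothOfRelativeDimension_of_forall_isClosed_finrank_cotangentSpace_eq [Smooth f] (n : ℕ)
    (h : ∀ x : X, IsClosed ({x} : Set X) →
      Module.finrank (ResidueField (X.presheaf.stalk x)) (CotangentSpace (X.presheaf.stalk x)) = n) :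
    SmoothOfRelativeDimension n f := by
  refine smoothOfRelativeDimension_of_forall_isClosed_ringKrullDim_stalk_eq f n fun x hx => ?_
  haveI := Literature.AlgebraicGeometry.Resolution.isRegularLocalRing_stalk_of_smooth_of_field f x
  rw [← (IsRegularLocalRing.iff_finrank_cotangentSpace _).mp this, h x hx]

/-! ### `iff` packagings -/

/-- `f : X → Spec K` is smooth of relative dimension `n` iff it is smooth and `dim 𝒪_{X,x} = n` at
every closed point. [cite: GortzWedhorn2020, Lemma 6.26 and Thm. 6.28] -/
theorem smoothOfRelativeDimension_iff_forall_isClosed_ringKrullDim_stalk_eq (n : ℕ) :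
    SmoothOfRelativeDimension n f ↔
      Smooth f ∧ ∀ x : X, IsClosed ({x} : Set X) → ringKrullDim (X.presheaf.stalk x) = n := by
  constructor
  · intro hf
    exact ⟨SmoothOfRelativeDimension.smooth n f, fun x hx =>
      ringKrullDim_stalk_eq_of_smoothOfRelativeDimension_of_isClosed f n hx⟩
  · rintro ⟨hf, h⟩
    exact smoothOfRelativeDimension_of_forall_isClosed_ringKrullDim_stalk_eq f n h

/-- `f : X → Spec K` is smooth of relative dimension `n` iff it is smooth and the Zariski tangent
space at every closed point has dimension `n`. [cite: GortzWedhorn2020, Thm. 6.28 (v)/(vi)] -/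
theorem smoothOfRelativeDimension_iff_forall_isClosed_finrank_cotangentSpace_eq (n : ℕ) :
    SmoothOfRelativeDimension n f ↔
      Smooth f ∧ ∀ x : X, IsClosed ({x} : Set X) →
        Module.finrank (ResidueField (X.presheaf.stalk x)) (CotangentSpace (X.presheaf.stalk x)) = n := by
  constructor
  · intro hf
    refine ⟨SmoothOfRelativeDimension.smooth n f, fun x hx => ?_⟩
    exact_mod_cast finrank_cotangentSpace_stalk_eq_of_smoothOfRelativeDimension_of_isClosed f n hx
  · rintro ⟨hf, h⟩
    exact smoothOfRelativeDimension_of_forall_isClosed_finrank_cotangentSpace_eq f n h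

end Literature.AlgebraicGeometry.Dimension
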